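import Mathlib

/-!
# Crux K2 `PoloidalWindowRigidity` (stmt-NavierStokesRegularity-19708), line `z_shock` — the ROTATING-SHEAR sector of the autonomous
# height-evolution: the z-shock in closed form (`q'' ≥ kq²` on the whole line), and an entire POLYNOMIAL twisting inhabitant once the type
# clause is dropped

`--supports stmt-NavierStokesRegularity-19708 --as helper` (leafhand-ns-poloidalwindowdoor-3 g31, cell decomp-ns, 2026-09-01).  Class-free,
def-free, Mathlib only.  **No stub and no summit is closed by this file; Navier–Stokes regularity is NOT proved here (rung 0).**
On an autonomous thick window the deciding stub `stub_zShockThickAut` of `Cruxes/PoloidalWindowRigidity/Lines/z_shock.lean` reduces (K-48;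
tree `…ZShockHeightEvolution`, `…ZShockSliceTyping`) to the scalar height-evolution `w_zz + Δₕ[G(w)] = 0`, slope `g = G'`
(`∂_z vₕ = g(w)∇ₕw`), type `g(w)|∇ₕw|² ≤ 0`, hyperbolic where `< 0`, genuinely nonlinear where `g'(w) ≠ 0`.  THE SECTOR: `w` AFFINE ON EVERY
HORIZONTAL PLANE with height-dependent shear («rotating shear»), `w = a(z)x + b(z)y + c(z)`, twist `∂₀w_z∂₁w − ∂₁w_z∂₀w = a'b − b'a ≠ 0`
iff the shear rotates (`rotatingShear_twist`); none of the census' symmetry classes (helical / conical / w-oblique `…/THICK-NF-K2p5.md`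
§3–5b, `…ZShockObliqueProfile`, simple waves `…ZShockSimpleWaves*`: here level sets are ruled surfaces, not planes).  With `Δₕw = 0`,
`|∇ₕw|² = a² + b²`, the PDE and the type clause read, at every `(x, y, z)` (dictionary `hasDerivAt_w_z` twice, `hasDerivAt_G_w_x/y`,
`hasDerivAt_gw_x/y`: (P) is literally `w_zz + ∂ₓ∂ₓG(w) + ∂_y∂_yG(w) = 0`):
  (P) `a''x + b''y + c'' + g'(ax + by + c)(a² + b²) = 0`,        (T) `g(ax + by + c)(a² + b²) ≤ 0`.
* `superquadratic_forward_false`, `superquadratic_entire_eq_zero` — ODE heart: `q ≥ 0`, `C²`, `q'' ≥ kq²` (`k > 0`) on the WHOLE line ⇒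
  `q ≡ 0` (energy `q'² − (2k/3)q³` monotone, then `(√q)⁻¹` decays at rate `≥ ½√(k/3)`: finite-height blow-up forward or backward).
* ★ `rotatingShear_rigid` — (P) ∧ (T) everywhere ⇒ the shear vanishes at every height (horizontally flat: no hyperbolic / twisting point)
  OR `g' ≡ 0` (no genuinely nonlinear point): at a height with `a² + b² > 0` the value `s = ax + by + c` is onto `ℝ`, so (P) makes `g'`
  AFFINE and (T) makes `g ≤ 0` on `ℝ`, hence `g' = κs + θ` with `κ < 0` (or `g' ≡ 0`); the `x`/`y`-coefficients of (P) give
  `a'' = |κ|(a²+b²)a`, `b'' = |κ|(a²+b²)b`, and `q = a² + b²` obeys `q'' ≥ 2|κ|q²` — the z-SHOCK of the line's thesis in closed form (genuine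
  nonlinearity + two-sided entireness ⇒ gradient catastrophe at finite height), NO boundedness used: one more exact sector of the autonomous
  thick column is empty, by the line's own mechanism.
* `rotatingShear_polynomial_P`, `hasDerivAt_polyOffset(_deriv)`, `rotatingShear_elliptic_point` — dropping (T): `g(s) = θs` (`G = θs²/2`,
  genuinely nonlinear everywhere for `θ ≠ 0`), AFFINE shear `a = a₀ + a₁z`, `b = b₀ + b₁z`, quartic offset with `c'' = −θ(a² + b²)` give an
  ENTIRE POLYNOMIAL solution of (P) with constant twist `a₁b₀ − a₀b₁`, whose type `θ·w·(a² + b²)` takes both signs.  So for entire analytic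
  patterns the differential clauses of `hGN` (`…ZShockAutOfSliceLiouville`) + twist + genuine nonlinearity + a hyperbolic half-space are
  CONSISTENT: a proof of `hGN` must use the GLOBAL sign of the type or boundedness (complements g24's pencil field — all clauses incl. the
  sign, not entire — and R2½ `…ZShockObliqueProfile`).  Honest scope: kinematic, scalar level, one ansatz sector; `hGN` / R3 stay XL, not
  in print.  presearch: «blow-up / Liouville for w_zz + ΔG(w) = 0 affine on planes; q'' ≥ kq² on ℝ» → [corpus: hormander1997 pp.303–306
  (John / Klainerman–Majda 1-D mechanism)] only; galaxy none. [folklore]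
-/

namespace Summit.NavierStokesRegularity.NavierStokesRegularity.Theorems.PoloidalWindowDoorPoloidalWindowRigidityZShockRotatingShear

-- the summit and its single sub-problem share the name (CONVENTIONS §1)
set_option linter.dupNamespace false

open Set Real Filter Topology

/-! ## The ODE heart: `q ≥ 0`, `q'' ≥ k q²` on the whole line forces `q ≡ 0` -/

/-- **Forward finite-height blow-up.**  `q` `C²` on `ℝ` with `q'' ≥ kq²` (`k > 0`), `q(z₁) > 0`, `q'(z₁) > 0` is impossible: the energy
`q'² − (2k/3)q³` is non-decreasing on `[z₁, ∞)`, so eventually `q' ≥ √(k/3)·q√q` and `(√q)⁻¹ + ½√(k/3)·z` is non-increasing — `(√q)⁻¹`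
would become negative. [folklore] -/
theorem superquadratic_forward_false {q q₁ q₂ : ℝ → ℝ} {k z₁ : ℝ} (hk : 0 < k)
    (hq : ∀ z, HasDerivAt q (q₁ z) z) (hq₁ : ∀ z, HasDerivAt q₁ (q₂ z) z)
    (hineq : ∀ z, k * q z ^ 2 ≤ q₂ z) (hpos : 0 < q z₁) (hslope : 0 < q₁ z₁) : False := by
  have hqd : Differentiable ℝ q := fun z => (hq z).differentiableAt
  have hq₁d : Differentiable ℝ q₁ := fun z => (hq₁ z).differentiableAt
  have hmono : Monotone q₁ := monotone_of_deriv_nonneg hq₁d fun z => by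
    rw [(hq₁ z).deriv]; exact (mul_nonneg hk.le (sq_nonneg _)).trans (hineq z)
  have hq₁ge : ∀ z, z₁ ≤ z → q₁ z₁ ≤ q₁ z := fun z hz => hmono hz
  have hlin : ∀ z, z₁ ≤ z → q z₁ + q₁ z₁ * (z - z₁) ≤ q z := by
    intro z hz
    have hD : ∀ t, HasDerivAt (fun t => q t - q₁ z₁ * t) (q₁ t - q₁ z₁ * 1) t :=
      fun t => (hq t).fun_sub ((hasDerivAt_id' t).const_mul (q₁ z₁))
    have hdiff : Differentiable ℝ (fun t => q t - q₁ z₁ * t) := fun t => (hD t).differentiableAt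
    have hmon : MonotoneOn (fun t => q t - q₁ z₁ * t) (Ici z₁) := by
      refine monotoneOn_of_deriv_nonneg (convex_Ici z₁) hdiff.continuous.continuousOn hdiff.differentiableOn ?_
      intro t ht
      rw [interior_Ici] at ht
      rw [(hD t).deriv]
      linarith [hq₁ge t (le_of_lt ht)]
    have h : q z₁ - q₁ z₁ * z₁ ≤ q z - q₁ z₁ * z := hmon (Set.mem_Ici.2 le_rfl) (Set.mem_Ici.2 hz) hz
    linarith
  have hqpos : ∀ z, z₁ ≤ z → 0 < q z := fun z hz => by nlinarith [hlin z hz, hslope.le, sub_nonneg.2 hz]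
  -- the energy `q₁² − (2k/3) q³` is non-decreasing on `[z₁, ∞)`
  have hE : ∀ t, HasDerivAt (fun t => q₁ t * q₁ t - (2 * k / 3) * (q t * q t * q t))
      (q₂ t * q₁ t + q₁ t * q₂ t - (2 * k / 3) * ((q₁ t * q t + q t * q₁ t) * q t + q t * q t * q₁ t)) t :=
    fun t => ((hq₁ t).fun_mul (hq₁ t)).fun_sub ((((hq t).fun_mul (hq t)).fun_mul (hq t)).const_mul _)
  have hEd : Differentiable ℝ (fun t => q₁ t * q₁ t - (2 * k / 3) * (q t * q t * q t)) := fun t => (hE t).differentiableAt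
  have hEmono : MonotoneOn (fun t => q₁ t * q₁ t - (2 * k / 3) * (q t * q t * q t)) (Ici z₁) := by
    refine monotoneOn_of_deriv_nonneg (convex_Ici z₁) hEd.continuous.continuousOn hEd.differentiableOn ?_
    intro t ht
    rw [interior_Ici] at ht
    rw [(hE t).deriv]
    have h1 : 0 ≤ q₁ t := hslope.le.trans (hq₁ge t (le_of_lt ht))
    have h2 : 0 ≤ q₂ t - k * q t ^ 2 := sub_nonneg.2 (hineq t)
    have : q₂ t * q₁ t + q₁ t * q₂ t - 2 * k / 3 * ((q₁ t * q t + q t * q₁ t) * q t + q t * q t * q₁ t)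
        = 2 * (q₁ t * (q₂ t - k * q t ^ 2)) := by ring
    rw [this]
    exact mul_nonneg (by norm_num) (mul_nonneg h1 h2)
  set E₁ := q₁ z₁ * q₁ z₁ - (2 * k / 3) * (q z₁ * q z₁ * q z₁) with hE₁_def
  have hEge : ∀ z, z₁ ≤ z → E₁ ≤ q₁ z * q₁ z - (2 * k / 3) * (q z * q z * q z) := fun z hz =>
    hEmono (Set.mem_Ici.2 le_rfl) (Set.mem_Ici.2 hz) hz
  set Q := max (max (q z₁) 1) (3 * |E₁| / k) with hQ_def
  have hQA : q z₁ ≤ Q := (le_max_left _ _).trans (le_max_left _ _)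
  have hQ1 : 1 ≤ Q := (le_max_right _ _).trans (le_max_left _ _)
  have hQE : 3 * |E₁| / k ≤ Q := le_max_right _ _
  set z₂ := z₁ + (Q - q z₁) / q₁ z₁ with hz₂_def
  have hz₁₂ : z₁ ≤ z₂ := by linarith [div_nonneg (sub_nonneg.2 hQA) hslope.le]
  have hqQ : ∀ z, z₂ ≤ z → Q ≤ q z := by
    intro z hz
    have h2 : q₁ z₁ * (z₂ - z₁) = Q - q z₁ := by rw [hz₂_def]; field_simp; ring
    linarith [hlin z (hz₁₂.trans hz), mul_le_mul_of_nonneg_left (show z₂ - z₁ ≤ z - z₁ by linarith) hslope.le]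
  -- on `[z₂, ∞)`: `q₁ ≥ m·q·√q` with `m = √(k/3)`
  set m := Real.sqrt (k / 3) with hm_def
  have hm : 0 < m := Real.sqrt_pos.2 (by positivity)
  have hmsq : m * m = k / 3 := Real.mul_self_sqrt (by positivity)
  have hkey : ∀ z, z₂ ≤ z → m * q z * Real.sqrt (q z) ≤ q₁ z := by
    intro z hz
    have hz₁z : z₁ ≤ z := hz₁₂.trans hz
    have hq0 : 0 < q z := hqpos z hz₁z
    have hq₁0 : 0 ≤ q₁ z := hslope.le.trans (hq₁ge z hz₁z)
    have hE' := hEge z hz₁z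
    have hcube : q z ≤ q z * q z * q z := by nlinarith [hQ1.trans (hqQ z hz)]
    have hkq : 3 * |E₁| ≤ k * q z := by linarith [(div_le_iff₀ hk).1 (hQE.trans (hqQ z hz))]
    have habs : -E₁ ≤ |E₁| := neg_le_abs E₁
    have hsq : (m * q z * Real.sqrt (q z)) * (m * q z * Real.sqrt (q z)) ≤ q₁ z * q₁ z := by
      have hs : Real.sqrt (q z) * Real.sqrt (q z) = q z := Real.mul_self_sqrt hq0.le
      have : (m * q z * Real.sqrt (q z)) * (m * q z * Real.sqrt (q z))
          = (m * m) * (q z * q z) * (Real.sqrt (q z) * Real.sqrt (q z)) := by ring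
      rw [this, hmsq, hs]
      nlinarith
    by_contra hlt
    push Not at hlt
    linarith [mul_self_lt_mul_self hq₁0 hlt]
  -- `(√q)⁻¹ + (m/2)·t` is non-increasing on `[z₂, ∞)`
  have hS : ∀ t, z₂ ≤ t → HasDerivAt (fun t => (Real.sqrt (q t))⁻¹ + m / 2 * t)
      (-(q₁ t / (2 * Real.sqrt (q t))) / Real.sqrt (q t) ^ 2 + m / 2 * 1) t := by
    intro t ht
    have hq0 : 0 < q t := hqpos t (hz₁₂.trans ht)
    have h1 : HasDerivAt (fun y => Real.sqrt (q y)) (q₁ t / (2 * Real.sqrt (q t))) t := (hq t).sqrt hq0.ne'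
    exact (h1.fun_inv (Real.sqrt_pos.2 hq0).ne').fun_add ((hasDerivAt_id' t).const_mul (m / 2))
  have hSle : ∀ t, z₂ ≤ t → -(q₁ t / (2 * Real.sqrt (q t))) / Real.sqrt (q t) ^ 2 + m / 2 * 1 ≤ 0 := by
    intro t ht
    have hq0 : 0 < q t := hqpos t (hz₁₂.trans ht)
    have hs0 : 0 < Real.sqrt (q t) := Real.sqrt_pos.2 hq0
    rw [Real.sq_sqrt hq0.le, neg_div]
    have hden : 0 < 2 * Real.sqrt (q t) * q t := by positivity
    have hfrac : m / 2 ≤ q₁ t / (2 * Real.sqrt (q t)) / q t := by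
      rw [div_div, le_div_iff₀ hden]
      nlinarith [hkey t ht]
    linarith
  have hSanti : AntitoneOn (fun t => (Real.sqrt (q t))⁻¹ + m / 2 * t) (Ici z₂) := by
    refine antitoneOn_of_deriv_nonpos (convex_Ici z₂) (fun t ht => (hS t ht).continuousAt.continuousWithinAt) ?_ ?_
    · rw [interior_Ici]
      exact fun t ht => (hS t (le_of_lt ht)).differentiableAt.differentiableWithinAt
    · intro t ht
      rw [interior_Ici] at ht
      rw [(hS t (le_of_lt ht)).deriv]
      exact hSle t (le_of_lt ht)
  set z₃ := z₂ + 2 / m * ((Real.sqrt (q z₂))⁻¹ + 1) with hz₃_def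
  have hinv₂ : 0 ≤ (Real.sqrt (q z₂))⁻¹ := inv_nonneg.2 (Real.sqrt_nonneg _)
  have hz₂₃ : z₂ ≤ z₃ := by linarith [show 0 ≤ 2 / m * ((Real.sqrt (q z₂))⁻¹ + 1) by positivity]
  have hanti : (Real.sqrt (q z₃))⁻¹ + m / 2 * z₃ ≤ (Real.sqrt (q z₂))⁻¹ + m / 2 * z₂ :=
    hSanti (Set.mem_Ici.2 le_rfl) (Set.mem_Ici.2 hz₂₃) hz₂₃
  have hcalc : m / 2 * z₃ = m / 2 * z₂ + ((Real.sqrt (q z₂))⁻¹ + 1) := by rw [hz₃_def]; field_simp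
  have hposinv : 0 < (Real.sqrt (q z₃))⁻¹ := inv_pos.2 (Real.sqrt_pos.2 (hqpos z₃ (hz₁₂.trans hz₂₃)))
  linarith

/-- **Two-sided Liouville for `q'' ≥ k q²`.**  A `C²` function `q ≥ 0` on the WHOLE line with `q'' ≥ kq²` (`k > 0`) vanishes identically:
where `q > 0` the slope `q'` is strictly increasing, so it is positive a little to the right or negative a little to the left, and
`superquadratic_forward_false` applies forward, or backward after the reflection `z ↦ −z` (which preserves the inequality). [folklore] -/
theorem superquadratic_entire_eq_zero {q q₁ q₂ : ℝ → ℝ} {k : ℝ} (hk : 0 < k)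
    (hq : ∀ z, HasDerivAt q (q₁ z) z) (hq₁ : ∀ z, HasDerivAt q₁ (q₂ z) z)
    (hineq : ∀ z, k * q z ^ 2 ≤ q₂ z) (hnn : ∀ z, 0 ≤ q z) : ∀ z, q z = 0 := by
  by_contra hne
  push Not at hne
  obtain ⟨z₀, hz₀⟩ := hne
  have hpos : 0 < q z₀ := lt_of_le_of_ne (hnn z₀) (Ne.symm hz₀)
  have hqd : Differentiable ℝ q := fun z => (hq z).differentiableAt
  have hq₁d : Differentiable ℝ q₁ := fun z => (hq₁ z).differentiableAt
  -- `q > 0` near `z₀`, so `q₁` is strictly increasing on `[z₀ − ε/2, z₀ + ε/2]`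
  obtain ⟨ε, hε, hball⟩ := Metric.eventually_nhds_iff.1
    ((continuous_const.continuousAt).eventually_lt hqd.continuous.continuousAt hpos)
  have hqposI : ∀ z ∈ Icc (z₀ - ε / 2) (z₀ + ε / 2), 0 < q z := by
    intro z hz
    apply hball
    rw [Real.dist_eq, abs_lt]
    constructor <;> linarith [hz.1, hz.2]
  have hstrict : StrictMonoOn q₁ (Icc (z₀ - ε / 2) (z₀ + ε / 2)) := by
    refine strictMonoOn_of_deriv_pos (convex_Icc _ _) hq₁d.continuous.continuousOn ?_
    intro t ht
    rw [interior_Icc] at ht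
    rw [(hq₁ t).deriv]
    have hqt : 0 < q t := hqposI t (Ioo_subset_Icc_self ht)
    exact lt_of_lt_of_le (by positivity) (hineq t)
  have hlt : q₁ (z₀ - ε / 2) < q₁ (z₀ + ε / 2) := hstrict ⟨le_rfl, by linarith⟩ ⟨by linarith, le_rfl⟩ (by linarith)
  rcases le_or_gt (q₁ (z₀ + ε / 2)) 0 with hbwd | hfwd
  · -- backward: reflect `z ↦ −z` and blow up forward from `−(z₀ − ε/2)`
    have hQ : ∀ z, HasDerivAt (fun t => q (-t)) (-q₁ (-z)) z :=
      fun z => ((hq (-z)).comp z (hasDerivAt_neg z)).congr_deriv (by ring)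
    have hQ₁ : ∀ z, HasDerivAt (fun t => -q₁ (-t)) (q₂ (-z)) z :=
      fun z => ((hq₁ (-z)).comp z (hasDerivAt_neg z)).fun_neg.congr_deriv (by ring)
    have h1 : 0 < q (-(-(z₀ - ε / 2))) := by rw [neg_neg]; exact hqposI _ ⟨le_rfl, by linarith⟩
    have h2 : 0 < -q₁ (-(-(z₀ - ε / 2))) := by rw [neg_neg]; linarith
    exact superquadratic_forward_false (q := fun t => q (-t)) (q₁ := fun t => -q₁ (-t)) (q₂ := fun t => q₂ (-t))
      (z₁ := -(z₀ - ε / 2)) hk hQ hQ₁ (fun z => hineq (-z)) h1 h2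
  · exact superquadratic_forward_false (z₁ := z₀ + ε / 2) hk hq hq₁ hineq (hqposI _ ⟨by linarith, le_rfl⟩) hfwd

/-! ## The rotating-shear sector of `w_zz + Δₕ[G(w)] = 0`: dictionary -/

/-- Dictionary (height derivative): for `w = a(z)x + b(z)y + c(z)`, `∂_z w = a'x + b'y + c'`; applied to `(a', b', c')` it gives
`∂_z∂_z w = a''x + b''y + c''`, the first three terms of (P). [folklore] -/
theorem hasDerivAt_w_z {a a₁ b b₁ c c₁ : ℝ → ℝ} (ha : ∀ z, HasDerivAt a (a₁ z) z) (hb : ∀ z, HasDerivAt b (b₁ z) z)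
    (hc : ∀ z, HasDerivAt c (c₁ z) z) (x y z : ℝ) :
    HasDerivAt (fun z => a z * x + b z * y + c z) (a₁ z * x + b₁ z * y + c₁ z) z :=
  (((ha z).mul_const x).fun_add ((hb z).mul_const y)).fun_add (hc z)

/-- Dictionary (first horizontal derivative of `G(w)`): `∂ₓ G(w) = g(w)·a` (`g = G'`). [folklore] -/
theorem hasDerivAt_G_w_x {G g : ℝ → ℝ} (hG : ∀ s, HasDerivAt G (g s) s) (a b c : ℝ → ℝ) (x y z : ℝ) :
    HasDerivAt (fun x => G (a z * x + b z * y + c z)) (g (a z * x + b z * y + c z) * a z) x :=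
  ((hG _).comp x ((((hasDerivAt_id' x).const_mul (a z)).add_const (b z * y)).add_const (c z))).congr_deriv (by ring)

/-- Dictionary (second horizontal derivative): `∂ₓ(g(w)·a) = g'(w)·a²`; with the `y`-versions, `Δₕ G(w) = g'(w)(a² + b²)` because
`Δₕ w = 0` — the last term of (P). [folklore] -/
theorem hasDerivAt_gw_x {g g₁ : ℝ → ℝ} (hg : ∀ s, HasDerivAt g (g₁ s) s) (a b c : ℝ → ℝ) (x y z : ℝ) :
    HasDerivAt (fun x => g (a z * x + b z * y + c z) * a z) (g₁ (a z * x + b z * y + c z) * a z ^ 2) x :=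
  (((hg _).comp x ((((hasDerivAt_id' x).const_mul (a z)).add_const (b z * y)).add_const (c z))).mul_const (a z)).congr_deriv
    (by ring)

/-- Dictionary, `y`-direction: `∂_y G(w) = g(w)·b`. [folklore] -/
theorem hasDerivAt_G_w_y {G g : ℝ → ℝ} (hG : ∀ s, HasDerivAt G (g s) s) (a b c : ℝ → ℝ) (x y z : ℝ) :
    HasDerivAt (fun y => G (a z * x + b z * y + c z)) (g (a z * x + b z * y + c z) * b z) y :=
  ((hG _).comp y ((((hasDerivAt_id' y).const_mul (b z)).const_add (a z * x)).add_const (c z))).congr_deriv (by ring)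

/-- Dictionary, `y`-direction: `∂_y(g(w)·b) = g'(w)·b²`. [folklore] -/
theorem hasDerivAt_gw_y {g g₁ : ℝ → ℝ} (hg : ∀ s, HasDerivAt g (g₁ s) s) (a b c : ℝ → ℝ) (x y z : ℝ) :
    HasDerivAt (fun y => g (a z * x + b z * y + c z) * b z) (g₁ (a z * x + b z * y + c z) * b z ^ 2) y :=
  (((hg _).comp y ((((hasDerivAt_id' y).const_mul (b z)).const_add (a z * x)).add_const (c z))).mul_const (b z)).congr_deriv
    (by ring)

/-! ## The rotating-shear sector: rigidity -/

/-- ★ **Rigidity of the rotating-shear sector (the z-shock in closed form).**  Let `a, b` be `C²` on `ℝ` (derivatives `a₁, a₂`, `b₁, b₂`),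
`c₂ : ℝ → ℝ` arbitrary (the second height-derivative of the offset `c`), `g` differentiable with derivative `g₁`.  If the height-evolution
(P) `a''x + b''y + c'' + g'(w)(a² + b²) = 0` and the type clause (T) `g(w)(a² + b²) ≤ 0` hold at EVERY point (`w = ax + by + c`), then either
the shear vanishes at every height (horizontally flat: no hyperbolic, no twisting point) or `g' ≡ 0` (no genuinely nonlinear point).  In the
remaining case the proof finds `g' = κs + θ` with `κ < 0`, `a'' = |κ|(a²+b²)a`, `b'' = |κ|(a²+b²)b`, so that `q = a² + b²` would satisfy
`q'' ≥ 2|κ|q²` on the whole line — finite-height gradient blow-up, excluded by `superquadratic_entire_eq_zero`.  No boundedness is used. [folklore] -/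
theorem rotatingShear_rigid {a a₁ a₂ b b₁ b₂ c c₂ g g₁ : ℝ → ℝ}
    (ha : ∀ z, HasDerivAt a (a₁ z) z) (ha₁ : ∀ z, HasDerivAt a₁ (a₂ z) z)
    (hb : ∀ z, HasDerivAt b (b₁ z) z) (hb₁ : ∀ z, HasDerivAt b₁ (b₂ z) z) (hg : ∀ s, HasDerivAt g (g₁ s) s)
    (hP : ∀ x y z, a₂ z * x + b₂ z * y + c₂ z + g₁ (a z * x + b z * y + c z) * (a z ^ 2 + b z ^ 2) = 0)
    (hT : ∀ x y z, g (a z * x + b z * y + c z) * (a z ^ 2 + b z ^ 2) ≤ 0) :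
    (∀ z, a z = 0 ∧ b z = 0) ∨ (∀ s, g₁ s = 0) := by
  by_cases hflat : ∀ z, a z = 0 ∧ b z = 0
  · exact Or.inl hflat
  right
  push Not at hflat
  obtain ⟨z₀, hz₀⟩ := hflat
  set ρ := a z₀ ^ 2 + b z₀ ^ 2 with hρ_def
  have hρ : 0 < ρ := by
    rw [hρ_def]
    rcases eq_or_ne (a z₀) 0 with h | h
    · have := hz₀ h; positivity
    · positivity
  have hρne : ρ ≠ 0 := hρ.ne'
  have hval : ∀ s, a z₀ * (a z₀ * (s - c z₀) / ρ) + b z₀ * (b z₀ * (s - c z₀) / ρ) + c z₀ = s := by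
    intro s
    have h1 : a z₀ * (a z₀ * (s - c z₀) / ρ) + b z₀ * (b z₀ * (s - c z₀) / ρ) = ρ * (s - c z₀) / ρ := by rw [hρ_def]; ring
    rw [h1, mul_div_cancel_left₀ _ hρne]
    ring
  have hgle : ∀ s, g s ≤ 0 := by
    intro s
    have h := hT (a z₀ * (s - c z₀) / ρ) (b z₀ * (s - c z₀) / ρ) z₀
    rw [hval s, ← hρ_def] at h
    by_contra hgs
    push Not at hgs
    linarith [mul_pos hgs hρ]
  -- (P) on the whole line of values: `g₁` is affine, `g₁ s = κ s + θ`
  set L := a z₀ * a₂ z₀ + b z₀ * b₂ z₀ with hL_def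
  set κ := -L / ρ ^ 2 with hκ_def
  set θ := (L * c z₀ - c₂ z₀ * ρ) / ρ ^ 2 with hθ_def
  have haff : ∀ s, g₁ s = κ * s + θ := by
    intro s
    have h := hP (a z₀ * (s - c z₀) / ρ) (b z₀ * (s - c z₀) / ρ) z₀
    rw [hval s, ← hρ_def] at h
    have hlin : a₂ z₀ * (a z₀ * (s - c z₀) / ρ) + b₂ z₀ * (b z₀ * (s - c z₀) / ρ) = L * (s - c z₀) / ρ := by rw [hL_def]; ring
    rw [hlin] at h
    have h' : g₁ s * ρ ^ 2 = -(L * (s - c z₀)) - c₂ z₀ * ρ := by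
      have h2 : (L * (s - c z₀) / ρ + c₂ z₀ + g₁ s * ρ) * ρ = 0 := by rw [h, zero_mul]
      have h3 : L * (s - c z₀) / ρ * ρ = L * (s - c z₀) := div_mul_cancel₀ _ hρne
      nlinarith [h2, h3]
    have h'' : g₁ s * ρ ^ 2 = (κ * s + θ) * ρ ^ 2 := by rw [h', hκ_def, hθ_def]; field_simp; ring
    exact mul_right_cancel₀ (pow_ne_zero 2 hρne) h''
  -- integrate: `g s = g 0 + κ s²/2 + θ s`
  have hgform : ∀ s, g s = g 0 + κ / 2 * s ^ 2 + θ * s := by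
    have hD : ∀ s, HasDerivAt (fun s => g s - (κ / 2 * s ^ 2 + θ * s)) (g₁ s - (κ / 2 * (2 * s) + θ * 1)) s := by
      intro s
      have hp : HasDerivAt (fun s : ℝ => s ^ 2) (2 * s) s := by simpa using hasDerivAt_pow 2 s
      exact (hg s).fun_sub ((hp.const_mul (κ / 2)).fun_add ((hasDerivAt_id' s).const_mul θ))
    have hzero : ∀ s, deriv (fun s => g s - (κ / 2 * s ^ 2 + θ * s)) s = 0 := fun s => by
      rw [(hD s).deriv, haff s]; ring
    intro s
    have h0 : g s - (κ / 2 * s ^ 2 + θ * s) = g 0 - (κ / 2 * 0 ^ 2 + θ * 0) :=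
      is_const_of_deriv_eq_zero (fun s => (hD s).differentiableAt) hzero s 0
    linarith
  -- `κ ≤ 0` (else `g(s) + g(−s) = 2g(0) + κs² > 0` for large `s`), and `κ = 0` forces `θ = 0`
  have hκle : κ ≤ 0 := by
    by_contra hκ
    push Not at hκ
    set s := (1 - 2 * g 0) / κ + 1 with hs_def
    have hs1 : 1 ≤ s := by
      have : 0 ≤ (1 - 2 * g 0) / κ := div_nonneg (by linarith [hgle 0]) hκ.le
      linarith
    have hks : 1 - 2 * g 0 ≤ κ * s ^ 2 := by
      have := mul_le_mul_of_nonneg_left (show (1 - 2 * g 0) / κ ≤ s ^ 2 by nlinarith) hκ.le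
      rwa [mul_div_cancel₀ _ hκ.ne'] at this
    have h1 := hgle s
    have h2 := hgle (-s)
    rw [hgform] at h1 h2
    nlinarith
  rcases lt_or_eq_of_le hκle with hκneg | hκzero
  · -- genuinely nonlinear case: the z-shock.  Coefficients of (P): `a'' = -κ(a²+b²)a`, `b'' = -κ(a²+b²)b`
    exfalso
    have hcoef : ∀ z, a₂ z = -κ * (a z ^ 2 + b z ^ 2) * a z ∧ b₂ z = -κ * (a z ^ 2 + b z ^ 2) * b z := by
      intro z
      have h0 := hP 0 0 z
      have h1 := hP 1 0 z
      have h2 := hP 0 1 z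
      simp only [mul_zero, mul_one, zero_add, add_zero] at h0 h1 h2
      rw [haff] at h0 h1 h2
      constructor <;> nlinarith
    -- `q = a² + b²` obeys `q'' ≥ (-2κ) q²` on the whole line
    have hq : ∀ z, HasDerivAt (fun t => a t * a t + b t * b t) (2 * (a z * a₁ z) + 2 * (b z * b₁ z)) z :=
      fun z => (((ha z).fun_mul (ha z)).fun_add ((hb z).fun_mul (hb z))).congr_deriv (by ring)
    have hq₁ : ∀ z, HasDerivAt (fun t => 2 * (a t * a₁ t) + 2 * (b t * b₁ t))
        (2 * (a₁ z * a₁ z + a z * a₂ z) + 2 * (b₁ z * b₁ z + b z * b₂ z)) z :=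
      fun z => (((ha z).fun_mul (ha₁ z)).const_mul 2).fun_add (((hb z).fun_mul (hb₁ z)).const_mul 2)
    have hineq : ∀ z, (-2 * κ) * (a z * a z + b z * b z) ^ 2 ≤
        2 * (a₁ z * a₁ z + a z * a₂ z) + 2 * (b₁ z * b₁ z + b z * b₂ z) := by
      intro z
      rw [(hcoef z).1, (hcoef z).2]
      nlinarith [sq_nonneg (a₁ z), sq_nonneg (b₁ z)]
    have hzero : a z₀ * a z₀ + b z₀ * b z₀ = 0 :=
      superquadratic_entire_eq_zero (k := -2 * κ) (by linarith) hq hq₁ hineq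
        (fun z => add_nonneg (mul_self_nonneg (a z)) (mul_self_nonneg (b z))) z₀
    have : ρ = a z₀ * a z₀ + b z₀ * b z₀ := by rw [hρ_def]; ring
    linarith
  · -- `κ = 0`: then `θ = 0`, i.e. `g₁ ≡ 0`
    have hθ : θ = 0 := by
      by_contra hθ
      have h := hgle ((1 - g 0) / θ)
      rw [hgform, hκzero] at h
      nlinarith [mul_div_cancel₀ (1 - g 0) hθ]
    intro s
    rw [haff s, hκzero, hθ]
    ring

/-! ## Dropping the type clause: an entire POLYNOMIAL twisting, genuinely nonlinear inhabitant -/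

/-- The twist of a rotating shear: with `∂₀w = a`, `∂₁w = b`, `∂₀∂_z w = a'`, `∂₁∂_z w = b'`, the stubs' twist scalar
`∂₀(∂_z w)·∂₁w − ∂₁(∂_z w)·∂₀w` is `a'b − b'a`; for the AFFINE shear `a = a₀ + a₁z`, `b = b₀ + b₁z` it is the constant `a₁b₀ − a₀b₁`
(non-zero as soon as the shear direction rotates). [folklore] -/
theorem rotatingShear_twist (a₀ a₁ b₀ b₁ z : ℝ) : a₁ * (b₀ + b₁ * z) - b₁ * (a₀ + a₁ * z) = a₁ * b₀ - a₀ * b₁ := by ring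

/-- The quartic offset `c(z) = −θ(a₀²z²/2 + a₀a₁z³/3 + a₁²z⁴/12 + b₀²z²/2 + b₀b₁z³/3 + b₁²z⁴/12)` has
`c'(z) = −θ(a₀²z + a₀a₁z² + a₁²z³/3 + b₀²z + b₀b₁z² + b₁²z³/3)`. [folklore] -/
theorem hasDerivAt_polyOffset (a₀ a₁ b₀ b₁ θ z : ℝ) :
    HasDerivAt (fun z => -θ * (a₀ ^ 2 * z ^ 2 / 2 + a₀ * a₁ * z ^ 3 / 3 + a₁ ^ 2 * z ^ 4 / 12 +
        b₀ ^ 2 * z ^ 2 / 2 + b₀ * b₁ * z ^ 3 / 3 + b₁ ^ 2 * z ^ 4 / 12))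
      (-θ * (a₀ ^ 2 * z + a₀ * a₁ * z ^ 2 + a₁ ^ 2 * z ^ 3 / 3 + b₀ ^ 2 * z + b₀ * b₁ * z ^ 2 + b₁ ^ 2 * z ^ 3 / 3)) z := by
  have h2 : HasDerivAt (fun z : ℝ => z ^ 2) (2 * z) z := by simpa using hasDerivAt_pow 2 z
  have h3 : HasDerivAt (fun z : ℝ => z ^ 3) (3 * z ^ 2) z := by simpa using hasDerivAt_pow 3 z
  have h4 : HasDerivAt (fun z : ℝ => z ^ 4) (4 * z ^ 3) z := by simpa using hasDerivAt_pow 4 z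
  exact ((((((((h2.const_mul (a₀ ^ 2)).div_const 2).fun_add ((h3.const_mul (a₀ * a₁)).div_const 3)).fun_add
    ((h4.const_mul (a₁ ^ 2)).div_const 12)).fun_add ((h2.const_mul (b₀ ^ 2)).div_const 2)).fun_add
    ((h3.const_mul (b₀ * b₁)).div_const 3)).fun_add ((h4.const_mul (b₁ ^ 2)).div_const 12)).const_mul (-θ)).congr_deriv (by ring)

/-- … and `c''(z) = −θ((a₀ + a₁z)² + (b₀ + b₁z)²) = −θ(a² + b²)`. [folklore] -/
theorem hasDerivAt_polyOffset_deriv (a₀ a₁ b₀ b₁ θ z : ℝ) :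
    HasDerivAt (fun z => -θ * (a₀ ^ 2 * z + a₀ * a₁ * z ^ 2 + a₁ ^ 2 * z ^ 3 / 3 + b₀ ^ 2 * z + b₀ * b₁ * z ^ 2 + b₁ ^ 2 * z ^ 3 / 3))
      (-θ * ((a₀ + a₁ * z) ^ 2 + (b₀ + b₁ * z) ^ 2)) z := by
  have h1 : HasDerivAt (fun z : ℝ => z) 1 z := hasDerivAt_id' z
  have h2 : HasDerivAt (fun z : ℝ => z ^ 2) (2 * z) z := by simpa using hasDerivAt_pow 2 z
  have h3 : HasDerivAt (fun z : ℝ => z ^ 3) (3 * z ^ 2) z := by simpa using hasDerivAt_pow 3 z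
  exact (((((((h1.const_mul (a₀ ^ 2)).fun_add (h2.const_mul (a₀ * a₁))).fun_add ((h3.const_mul (a₁ ^ 2)).div_const 3)).fun_add
    (h1.const_mul (b₀ ^ 2))).fun_add (h2.const_mul (b₀ * b₁))).fun_add ((h3.const_mul (b₁ ^ 2)).div_const 3)).const_mul (-θ)).congr_deriv
    (by ring)

/-- **The polynomial inhabitant solves (P) at every point.**  With `g(s) = θs` (`g' ≡ θ`: genuinely nonlinear everywhere for `θ ≠ 0`;
`G = θs²/2`), affine shear `a = a₀ + a₁z`, `b = b₀ + b₁z` (`a'' = b'' = 0`) and the quartic offset of `hasDerivAt_polyOffset(_deriv)`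
(`c'' = −θ((a₀+a₁z)² + (b₀+b₁z)²)`), (P) `a''x + b''y + c'' + g'(w)(a² + b²) = 0` holds on all of `ℝ³`: `w` is an ENTIRE POLYNOMIAL solution
of `w_zz + Δₕ[G(w)] = 0`, twisting whenever `a₁b₀ ≠ a₀b₁` (`rotatingShear_twist`). [folklore] -/
theorem rotatingShear_polynomial_P (a₀ a₁ b₀ b₁ θ x y z : ℝ) :
    0 * x + 0 * y + (-θ * ((a₀ + a₁ * z) ^ 2 + (b₀ + b₁ * z) ^ 2)) + θ * ((a₀ + a₁ * z) ^ 2 + (b₀ + b₁ * z) ^ 2) = 0 := by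
  ring

/-- **… but it has strictly ELLIPTIC points** ((T) fails on a half-space): on a plane where the shear is `(a₀, b₀)` with `a₀ ≠ 0` and the
offset value is `c₀`, if `θ ≠ 0` the value `w = 1/θ` is attained (at `x = (1/θ − c₀)/a₀`, `y = 0`) and there `g(w)(a² + b²) = a₀² + b₀² > 0`.
So for ENTIRE real-analytic patterns the differential clauses + twist + genuine nonlinearity + a hyperbolic half-space are consistent; what a
proof of `hGN` must use is the GLOBAL sign of the type or boundedness. [folklore] -/
theorem rotatingShear_elliptic_point {a₀ θ : ℝ} (hθ : θ ≠ 0) (ha₀ : a₀ ≠ 0) (b₀ c₀ : ℝ) :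
    ∃ x y : ℝ, 0 < θ * (a₀ * x + b₀ * y + c₀) * (a₀ ^ 2 + b₀ ^ 2) := by
  refine ⟨(1 / θ - c₀) / a₀, 0, ?_⟩
  have hw : θ * (a₀ * ((1 / θ - c₀) / a₀) + b₀ * 0 + c₀) = 1 := by field_simp; ring
  rw [hw, one_mul]
  have : 0 < a₀ ^ 2 := by positivity
  nlinarith [sq_nonneg b₀]

end Summit.NavierStokesRegularity.NavierStokesRegularity.Theorems.PoloidalWindowDoorPoloidalWindowRigidityZShockRotatingShear
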